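import Summits.Ventures.CertifiedManyBodySolver.Downfold.ThreeToOneBand
import Literature.MathematicalPhysics.QuantumLattice.EmeryThreeBandByDecoration
import Literature.Computation.Certificates.BoxCoveringByCells
import Mathlib.Data.Fin.VecNotation
import Mathlib.Order.Interval.Set.Pi
import HarnessLib

/-!
# The S1/S2 seam for THREE-BAND (`3BE`) words, in S2's own shape: a material's Emery box
# delivered as the six-parameter box of the decorated `CuO₂` model, with its three doors
# (∀-on-box ⇒ box word, vertex floors by concavity, Lipschitz width budget)

Venture CertifiedManyBodySolver, cell `pub/hubbard-downfold` (stage S1 = DOWNFOLDING FRONT END =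
ROUTER; HUMAN RULINGS D-0096/D-0098), seat hubbard-downfold-mod-4 (technique B; typed 3 → 1
statement `Downfold.ThreeToOneBand`); namespace `Summit.Ventures.CertifiedManyBodySolver.Downfold`.
Companion of `Downfold.S2Seam` (mod-1: the ONE-band seam `(U/t, t'/t, n)`). Everything here is
PROVED; no number about any material lives here. HONEST FRAMING: an Emery box is a systematic
modelling claim (hypothesis `E.Mem p`, SCREENING-GRADE entries with provenance in
`router/BOXES/<material>.md` / `router/EMERY-LINE-ROWS.tsv`); the certified content is S2's; the
identification of a material with the three-band model is the router's `3BE` word, never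
discharged in Lean.

The situation. Stage S2 now has a TYPED TARGET for the three-band model
(`Literature/MathematicalPhysics/QuantumLattice/EmeryThreeBandByDecoration`, cell `pub/hubbard-fast`,
hubbard-box-p1): the variational energy density `emeryEnergyDensity θ ρ` of the `2 × 2`-decorated
`CuO₂` lattice at coupling vector `θ ∈ ℝ¹⁴`, reached from the SIX PHYSICAL PARAMETERS
`q = (t_pd, t_pp, ε_d, ε_p, U_d, U_p)` through the linear map `emeryLine s` (`s` = the O–O sign
pattern, S2's choice), jointly concave along that line (`concaveOn_emeryEnergyDensity_line`) and
jointly Lipschitz with class constants `(2,…,2,1,1,1)` (`abs_emeryEnergyDensity_sub_le`). Stage S1's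
`3BE` block is the typed `EmeryBox = Box EmeryCoord` (`Delta_pd, t_pd, t_pp, t_pp', U_dd, U_pp,
V_pd, n_holes`; rational graded entries). This file is the adapter and nothing else:

* §1 `emeryLineCoords εp p = ![p t_pd, p t_pp, εp + p Δ_pd, εp, p U_dd, p U_pp]` — a 3BE parameter
  vector read in S2's order at a DECLARED oxygen reference level `εp` (the model's energy words
  depend on `(ε_d, ε_p)` only through `Δ = ε_d − ε_p` up to the trivial `εp ·`filling shift; the
  level object — bare Wannier level vs double-counting-corrected level — is the TAG OF RECORD of
  the box's `Delta_pd` entry, not a choice made here); `emeryLo / emeryHi εp eA eB eD eUd eUp` — the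
  delivered box corners from the five entries' claimed enclosures; `emeryLineCoords_mem_Icc` —
  `E.Mem p` ⇒ the line point lies in the delivered `Set.Icc`; the cell filling S2 quantifies over is
  `emeryCellFilling p = (6 − n_holes)/4` (four sites per decorated cell, dummy empty), enclosed by
  `emeryCellFilling_mem_Icc` (antitone in `n_holes`). `t_pp'` and `V_pd` have no direction in the
  decorated model of record (they would be two more `viewFamily` directions); they ride in the box
  as printed rows and constrain nothing here.
* §2 DOOR 1 `holdsOn_of_forall_emeryLineBox` — any S2 statement `∀ q ∈ Set.Icc lo hi, W q` about the
  delivered box becomes the box word `HoldsOn (fun p => W (emeryLineCoords εp p)) E`.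
* §3 DOOR 2 (vertex floors) `le_of_concaveOn_of_forall_boxVertices` — a function concave on a
  coordinate box is bounded below on the box by its minimum over the `2^|κ|` vertices
  (`BoxCovering.exists_convexWeights_boxVertices` + Jensen); hence
  `le_emeryEnergyDensity_line_of_mem_Icc` (a floor S2 certifies at the `64` vertices of a
  six-parameter box holds in the box) and `holdsOn_emeryEnergyFloor` (… and is a box word of the
  material's Emery box).
* §4 DOOR 3 (width budget) `sum_emeryConstants_mul_abs_emeryLine_sub` — along the physical line the
  joint Lipschitz constant reads `8|Δt_pd| + 2(Σ_k |s_k|)|Δt_pp| + 2|Δε_d| + 4|Δε_p| + |ΔU_d| + 2|ΔU_p|`;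
  `abs_emeryEnergyDensity_line_sub_le` (unit sign pattern: `8, 8, 2, 4, 1, 2`) and
  `abs_emeryEnergyDensity_sub_le_of_mem_emeryLineBox` — two parameter vectors of the SAME delivered
  box differ in certified energy density by at most `8·w(t_pd) + 8·w(t_pp) + 2·w(Δ_pd) + w(U_dd) +
  2·w(U_pp)` (`w` = claimed enclosure width): the ENERGY PRICE OF THE 3BE BOX WIDTH, the number the
  router's inflation rules trade against.
-/

namespace Summit.Ventures.CertifiedManyBodySolver.Downfold

open NonemptyInterval Literature.Analysis.ValidatedNumerics
open Literature.MathematicalPhysics.QuantumLattice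
open Literature.Computation.Certificates.BoxCovering
open scoped BigOperators

/-! ## §1 The delivered six-parameter box of an Emery box -/

/-- **S2's six physical parameters read off a 3BE parameter vector** at declared oxygen reference
level `εp`: `(t_pd, t_pp, ε_d, ε_p, U_d, U_p) = (p t_pd, p t_pp, εp + p Δ_pd, εp, p U_dd, p U_pp)`
(electron one-body levels: the `d` level sits `Δ_pd` above the `p` level; `Δ_pd` = the box's
charge-transfer entry, whose level object is its tag of record). [cite: PavariniEtAl2001, eq. (1)] -/
def emeryLineCoords (εp : ℝ) (p : EmeryCoord → ℝ) : Fin 6 → ℝ :=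
  ![p .tpd, p .tpp, εp + p .DeltaPd, εp, p .Udd, p .Upp]

/-- The six coordinates of `emeryLineCoords εp p`, by name. [folklore] -/
theorem emeryLineCoords_apply (εp : ℝ) (p : EmeryCoord → ℝ) :
    emeryLineCoords εp p 0 = p .tpd ∧ emeryLineCoords εp p 1 = p .tpp ∧
      emeryLineCoords εp p 2 = εp + p .DeltaPd ∧ emeryLineCoords εp p 3 = εp ∧
      emeryLineCoords εp p 4 = p .Udd ∧ emeryLineCoords εp p 5 = p .Upp :=
  ⟨rfl, rfl, rfl, rfl, rfl, rfl⟩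

/-- Lower corner of the delivered six-parameter box from the `t_pd`, `t_pp`, `Delta_pd`, `U_dd`,
`U_pp` entries at reference level `εp`. [folklore] -/
def emeryLo (εp : ℚ) (eA eB eD eUd eUp : Entry) : Fin 6 → ℝ :=
  ![((eA.encl.fst : ℚ) : ℝ), ((eB.encl.fst : ℚ) : ℝ), ((εp + eD.encl.fst : ℚ) : ℝ), ((εp : ℚ) : ℝ),
    ((eUd.encl.fst : ℚ) : ℝ), ((eUp.encl.fst : ℚ) : ℝ)]

/-- Upper corner of the delivered six-parameter box. [folklore] -/
def emeryHi (εp : ℚ) (eA eB eD eUd eUp : Entry) : Fin 6 → ℝ :=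
  ![((eA.encl.snd : ℚ) : ℝ), ((eB.encl.snd : ℚ) : ℝ), ((εp + eD.encl.snd : ℚ) : ℝ), ((εp : ℚ) : ℝ),
    ((eUd.encl.snd : ℚ) : ℝ), ((eUp.encl.snd : ℚ) : ℝ)]

/-- **The delivered box of an Emery box.** If `E` carries entries for `t_pd`, `t_pp`, `Delta_pd`,
`U_dd`, `U_pp`, every parameter vector of `E`, read in S2's order at reference level `εp`, lies in
`Set.Icc (emeryLo εp …) (emeryHi εp …)`. [folklore] -/
theorem emeryLineCoords_mem_Icc {E : EmeryBox} {eA eB eD eUd eUp : Entry} {εp : ℚ}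
    (hA : E .tpd = some eA) (hB : E .tpp = some eB) (hD : E .DeltaPd = some eD)
    (hUd : E .Udd = some eUd) (hUp : E .Upp = some eUp) {p : EmeryCoord → ℝ} (hp : E.Mem p) :
    emeryLineCoords (εp : ℝ) p ∈ Set.Icc (emeryLo εp eA eB eD eUd eUp) (emeryHi εp eA eB eD eUd eUp) := by
  have ha := mem_ratCast_iff.1 (hp _ _ hA)
  have hb := mem_ratCast_iff.1 (hp _ _ hB)
  have hd := mem_ratCast_iff.1 (hp _ _ hD)
  have hud := mem_ratCast_iff.1 (hp _ _ hUd)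
  have hup := mem_ratCast_iff.1 (hp _ _ hUp)
  rw [Set.mem_Icc, Pi.le_def, Pi.le_def]
  refine ⟨fun k => ?_, fun k => ?_⟩ <;> fin_cases k <;>
    simp [emeryLineCoords, emeryLo, emeryHi, ha.1, ha.2, hb.1, hb.2, hd.1, hd.2, hud.1, hud.2,
      hup.1, hup.2]

/-- **The cell filling of the decorated model** for a 3BE parameter vector: `n_holes` holes per
`CuO₂` unit = `6 − n_holes` electrons on the three orbitals of a `2 × 2` cell (dummy site empty) =
cell filling `(6 − n_holes)/4` per site of `ℤ²`. [cite: ArakiMoriya2003, §4.1 Def. 4.5] -/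
noncomputable def emeryCellFilling (p : EmeryCoord → ℝ) : ℝ := (6 - p .nHoles) / 4

/-- **Enclosure of the cell filling** from the `n_holes` entry (antitone: the upper hole count gives
the lower filling). [folklore] -/
theorem emeryCellFilling_mem_Icc {E : EmeryBox} {eN : Entry} (hN : E .nHoles = some eN)
    {p : EmeryCoord → ℝ} (hp : E.Mem p) :
    emeryCellFilling p ∈ Set.Icc ((((6 : ℚ) - eN.encl.snd) / 4 : ℚ) : ℝ) ((((6 : ℚ) - eN.encl.fst) / 4 : ℚ) : ℝ) := by
  have hn := mem_ratCast_iff.1 (hp _ _ hN)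
  simp only [emeryCellFilling, Set.mem_Icc, Rat.cast_div, Rat.cast_sub, Rat.cast_ofNat]
  constructor <;> linarith [hn.1, hn.2]

/-! ## §2 Door 1: an S2 statement about the delivered box is a box word -/

/-- **S2 box statement ⇒ 3BE box word.** Any statement `∀ q ∈ Set.Icc (emeryLo …) (emeryHi …), W q`
about the delivered six-parameter box (the conclusion shape of box-word theorems for the decorated
model; filling, sign pattern and ground-state data carried inside `W`) holds on the Emery box as
`p ↦ W (emeryLineCoords εp p)`. [folklore] -/
theorem holdsOn_of_forall_emeryLineBox {E : EmeryBox} {eA eB eD eUd eUp : Entry} {εp : ℚ}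
    (hA : E .tpd = some eA) (hB : E .tpp = some eB) (hD : E .DeltaPd = some eD)
    (hUd : E .Udd = some eUd) (hUp : E .Upp = some eUp) {W : (Fin 6 → ℝ) → Prop}
    (hW : ∀ q ∈ Set.Icc (emeryLo εp eA eB eD eUd eUp) (emeryHi εp eA eB eD eUd eUp), W q) :
    HoldsOn (fun p : EmeryCoord → ℝ => W (emeryLineCoords (εp : ℝ) p)) E :=
  fun _ hp => hW _ (emeryLineCoords_mem_Icc hA hB hD hUd hUp hp)

/-! ## §3 Door 2: vertex floors by concavity along the physical line -/

/-- **Concave on a coordinate box ⇒ bounded below by the vertex minimum.** If `f` is concave and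
`m ≤ f v` at each of the `2^|κ|` vertices `v` of `Set.Icc lo hi`, then `m ≤ f θ` on the whole box
(barycentric weights on the vertices + Jensen). [cite: Rockafellar1970, Thm 32.2] -/
theorem le_of_concaveOn_of_forall_boxVertices {κ : Type*} [Fintype κ] [DecidableEq κ]
    {f : (κ → ℝ) → ℝ} (hf : ConcaveOn ℝ Set.univ f) (lo hi : κ → ℝ) {m : ℝ}
    (hm : ∀ v ∈ Fintype.piFinset (fun k => ({lo k, hi k} : Finset ℝ)), m ≤ f v)
    {θ : κ → ℝ} (hθ : θ ∈ Set.Icc lo hi) : m ≤ f θ := by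
  obtain ⟨w, hw0, hw1, hsum⟩ := exists_convexWeights_boxVertices lo hi hθ
  have hJ := hf.le_map_sum hw0 hw1 (fun v _ => Set.mem_univ v)
  rw [hsum] at hJ
  refine le_trans ?_ hJ
  calc m = ∑ v ∈ Fintype.piFinset (fun k => ({lo k, hi k} : Finset ℝ)), w v * m := by
        rw [← Finset.sum_mul, hw1, one_mul]
    _ ≤ _ := Finset.sum_le_sum fun v hv => by
        rw [smul_eq_mul]; exact mul_le_mul_of_nonneg_left (hm v hv) (hw0 v hv)

/-- **Convex on a coordinate box ⇒ bounded above by the vertex maximum** (the mirror statement,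
for caps of convex quantities). [cite: Rockafellar1970, Thm 32.2] -/
theorem le_of_convexOn_of_forall_boxVertices {κ : Type*} [Fintype κ] [DecidableEq κ]
    {f : (κ → ℝ) → ℝ} (hf : ConvexOn ℝ Set.univ f) (lo hi : κ → ℝ) {M : ℝ}
    (hM : ∀ v ∈ Fintype.piFinset (fun k => ({lo k, hi k} : Finset ℝ)), f v ≤ M)
    {θ : κ → ℝ} (hθ : θ ∈ Set.Icc lo hi) : f θ ≤ M := by
  have h := le_of_concaveOn_of_forall_boxVertices (f := fun x => -f x) hf.neg lo hi (m := -M)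
    (fun v hv => neg_le_neg (hM v hv)) hθ
  simpa using h

/-- **Vertex floors for the decorated three-band model along the physical line**: a floor `m`
certified at the `64` vertices of a six-parameter box `Set.Icc lo hi ∋ (t_pd, t_pp, ε_d, ε_p, U_d,
U_p)` (any O–O sign pattern `s`, any cell filling `ρ`) holds at every point of the box.
[cite: Israel1979, Thm. I.3.4] -/
theorem le_emeryEnergyDensity_line_of_mem_Icc (s : Fin 4 → ℝ) (ρ : ℝ) (lo hi : Fin 6 → ℝ) {m : ℝ}
    (hm : ∀ v ∈ Fintype.piFinset (fun k => ({lo k, hi k} : Finset ℝ)),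
      m ≤ emeryEnergyDensity (emeryLine s v) ρ)
    {q : Fin 6 → ℝ} (hq : q ∈ Set.Icc lo hi) : m ≤ emeryEnergyDensity (emeryLine s q) ρ :=
  le_of_concaveOn_of_forall_boxVertices (concaveOn_emeryEnergyDensity_line s ρ) lo hi hm hq

/-- **A vertex-certified three-band energy floor is a box word of the material's Emery box**: if S2
certifies `m ≤ e(emeryLine s v, ρ)` at the `64` vertices `v` of the delivered box of `E` (reference
level `εp`), then `m ≤ e(emeryLine s (emeryLineCoords εp p), ρ)` for every parameter vector `p` of
`E`. [cite: Israel1979, Thm. I.3.4] -/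
theorem holdsOn_emeryEnergyFloor {E : EmeryBox} {eA eB eD eUd eUp : Entry} {εp : ℚ}
    (hA : E .tpd = some eA) (hB : E .tpp = some eB) (hD : E .DeltaPd = some eD)
    (hUd : E .Udd = some eUd) (hUp : E .Upp = some eUp) (s : Fin 4 → ℝ) (ρ : ℝ) {m : ℝ}
    (hm : ∀ v ∈ Fintype.piFinset
        (fun k => ({emeryLo εp eA eB eD eUd eUp k, emeryHi εp eA eB eD eUd eUp k} : Finset ℝ)),
      m ≤ emeryEnergyDensity (emeryLine s v) ρ) :
    HoldsOn (fun p : EmeryCoord → ℝ =>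
      m ≤ emeryEnergyDensity (emeryLine s (emeryLineCoords (εp : ℝ) p)) ρ) E :=
  holdsOn_of_forall_emeryLineBox hA hB hD hUd hUp
    (fun _ hq => le_emeryEnergyDensity_line_of_mem_Icc s ρ _ _ hm hq)

/-! ## §4 Door 3: the energy price of the box width along the physical line -/

/-- **The joint Lipschitz constant read along the physical line**: with class constants
`(2,…,2,1,1,1)` on the fourteen directions and `emeryLine s q = (q₀,q₀,q₀,q₀, s₀q₁,…,s₃q₁, q₂, q₃,
q₃, q₄, q₅, q₅)`, the weighted coupling distance is
`8|Δq₀| + 2(Σ_k|s_k|)|Δq₁| + 2|Δq₂| + 4|Δq₃| + |Δq₄| + 2|Δq₅|`. [cite: PavariniEtAl2001, eq. (1)] -/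
theorem sum_emeryConstants_mul_abs_emeryLine_sub (s : Fin 4 → ℝ) (q q' : Fin 6 → ℝ) :
    ∑ a, emeryConstants a * |emeryLine s q a - emeryLine s q' a| =
      8 * |q 0 - q' 0| + 2 * (|s 0| + |s 1| + |s 2| + |s 3|) * |q 1 - q' 1| + 2 * |q 2 - q' 2| +
        4 * |q 3 - q' 3| + |q 4 - q' 4| + 2 * |q 5 - q' 5| := by
  have hk : ∀ k : Fin 4, |s k * q 1 - s k * q' 1| = |s k| * |q 1 - q' 1| := fun k => by
    rw [← mul_sub, abs_mul]
  simp only [Fin.sum_univ_succ, Fin.sum_univ_zero, emeryConstants, emeryLine, LinearMap.coe_mk,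
    AddHom.coe_mk, Matrix.cons_val_zero, Matrix.cons_val_succ, hk]
  ring

/-- **Lipschitz bound along the physical line, unit sign pattern** (`|s_k| ≤ 1`): at a realised
filling, `|e(q) − e(q')| ≤ 8|Δt_pd| + 8|Δt_pp| + 2|Δε_d| + 4|Δε_p| + |ΔU_d| + 2|ΔU_p|`.
[cite: Israel1979, Thm. I.3.4] -/
theorem abs_emeryEnergyDensity_line_sub_le {ρ : ℝ} (hne : (emeryStates ρ).Nonempty) {s : Fin 4 → ℝ}
    (hs : ∀ k, |s k| ≤ 1) (q q' : Fin 6 → ℝ) :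
    |emeryEnergyDensity (emeryLine s q) ρ - emeryEnergyDensity (emeryLine s q') ρ| ≤
      8 * |q 0 - q' 0| + 8 * |q 1 - q' 1| + 2 * |q 2 - q' 2| + 4 * |q 3 - q' 3| + |q 4 - q' 4| +
        2 * |q 5 - q' 5| := by
  have h := abs_emeryEnergyDensity_sub_le hne (emeryLine s q) (emeryLine s q')
  rw [sum_emeryConstants_mul_abs_emeryLine_sub] at h
  have h1 : 2 * (|s 0| + |s 1| + |s 2| + |s 3|) * |q 1 - q' 1| ≤ 8 * |q 1 - q' 1| := by
    have := abs_nonneg (q 1 - q' 1)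
    nlinarith [hs 0, hs 1, hs 2, hs 3]
  linarith

/-- Width of an entry's claimed enclosure, cast to `ℝ`. [folklore] -/
def Entry.widthR (e : Entry) : ℝ := ((e.encl.snd : ℚ) : ℝ) - ((e.encl.fst : ℚ) : ℝ)

/-- Two reals in an entry's claimed enclosure differ by at most its width. [folklore] -/
theorem Entry.abs_sub_le_widthR {e : Entry} {x y : ℝ} (hx : e.Mem x) (hy : e.Mem y) :
    |x - y| ≤ e.widthR := by
  have hx' := mem_ratCast_iff.1 hx
  have hy' := mem_ratCast_iff.1 hy
  rw [Entry.widthR, abs_sub_le_iff]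
  constructor <;> linarith [hx'.1, hx'.2, hy'.1, hy'.2]

/-- **THE ENERGY PRICE OF THE 3BE BOX WIDTH.** Two parameter vectors of the same Emery box give
certified three-band energy densities (unit sign pattern, common reference level, realised filling)
within `8·w(t_pd) + 8·w(t_pp) + 2·w(Delta_pd) + w(U_dd) + 2·w(U_pp)` of each other, `w` the claimed
enclosure widths — the quantity the router's box inflation trades against a certified energy gap.
[cite: Israel1979, Thm. I.3.4] -/
theorem abs_emeryEnergyDensity_sub_le_of_mem_emeryLineBox {E : EmeryBox} {eA eB eD eUd eUp : Entry}
    (hA : E .tpd = some eA) (hB : E .tpp = some eB) (hD : E .DeltaPd = some eD)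
    (hUd : E .Udd = some eUd) (hUp : E .Upp = some eUp) {ρ : ℝ} (hne : (emeryStates ρ).Nonempty)
    {s : Fin 4 → ℝ} (hs : ∀ k, |s k| ≤ 1) (εp : ℝ) {p p' : EmeryCoord → ℝ} (hp : E.Mem p)
    (hp' : E.Mem p') :
    |emeryEnergyDensity (emeryLine s (emeryLineCoords εp p)) ρ -
        emeryEnergyDensity (emeryLine s (emeryLineCoords εp p')) ρ| ≤
      8 * eA.widthR + 8 * eB.widthR + 2 * eD.widthR + eUd.widthR + 2 * eUp.widthR := by
  have h := abs_emeryEnergyDensity_line_sub_le hne hs (emeryLineCoords εp p) (emeryLineCoords εp p')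
  have h0 := Entry.abs_sub_le_widthR (hp _ _ hA) (hp' _ _ hA)
  have h1 := Entry.abs_sub_le_widthR (hp _ _ hB) (hp' _ _ hB)
  have h2 := Entry.abs_sub_le_widthR (hp _ _ hD) (hp' _ _ hD)
  have h4 := Entry.abs_sub_le_widthR (hp _ _ hUd) (hp' _ _ hUd)
  have h5 := Entry.abs_sub_le_widthR (hp _ _ hUp) (hp' _ _ hUp)
  obtain ⟨e0, e1, e2, e3, e4, e5⟩ := emeryLineCoords_apply εp p
  obtain ⟨e0', e1', e2', e3', e4', e5'⟩ := emeryLineCoords_apply εp p'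
  rw [e0, e1, e2, e3, e4, e5, e0', e1', e2', e3', e4', e5'] at h
  rw [show εp + p .DeltaPd - (εp + p' .DeltaPd) = p .DeltaPd - p' .DeltaPd by ring, sub_self,
    abs_zero, mul_zero, add_zero] at h
  linarith

end Summit.Ventures.CertifiedManyBodySolver.Downfold
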